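import Literature.AlgebraicGeometry.AbelianSchemes.AbelianSchemeConstSubgroupQuotient
import Literature.AlgebraicGeometry.RelativeSpec.GeometricQuotientGroupLaw
import Literature.AlgebraicGeometry.Morphisms.GeometricallyConnectedOfSurjectiveComp
import HarnessLib

/-!
# The quotient of an abelian scheme by a finite constant subgroup: group law and connected fibres
# (Mumford, *Abelian Varieties* §7 Thm. 4 — the PROOF companion of `AbelianSchemeConstSubgroupQuotient`)

`AbelianSchemes/AbelianSchemeConstSubgroupQuotient` (HECKE-LINK file (i), cell hodgecm-mathlib) constructs, for
an abelian scheme `A → S`, a finite subgroup `K ⊆ A(S)` of sections acting by translations and a cover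
`hcov` of the total space by `K`-stable affine opens, the quotient `S`-scheme `A.quotientOver u K` with
its quotient map `ψ = A.quotientMk u K hcov`, and assembles the abelian scheme
`A.quotientBy u K hcov hG hsm hgc` from three RAW hypotheses. This file DISCHARGES two of them:

* `exists_grpObj_isMonHom_quotientMk` — **`hG`**: `A/K` carries an `S`-group-scheme structure for which
  `ψ` is a homomorphism (★ `RelativeSpec/GeometricQuotientGroupLaw`: the law of the COMMUTATIVE group
  object `A.X` descends along the free finite quotient `ψ`; the three compatibilities are file (i)'s
  `translation_whiskerRight_comp_mul`, `whiskerLeft_translation_comp_mul`, `translation_comp_inv`), for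
  `Y` affine and `K` acting freely on geometric points;
* `geometricallyConnected_quotientOver_hom` — **`hgc`**: the fibres of `A/K → S` are geometrically
  connected (★ `Morphisms/GeometricallyConnectedOfSurjectiveComp` applied to the surjective `ψ`).

The third hypothesis `hsm` (smoothness of `A/K → S`) is `AbelianSchemes/AbelianSchemeConstSubgroupQuotientSmooth`
(B-p09/B-p15). Commutativity `[IsCommMonObj A.X]` is ★ `isCommMonObj_of_isReduced_base` over reduced
locally Noetherian bases. Everything is proved; no named facts, no definitions.

## References

* D. Mumford, *Abelian Varieties* (1970), §7 Thm. 4 (p. 72). [MumfordAV1970]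
-/

noncomputable section

universe u

open CategoryTheory CategoryTheory.Limits AlgebraicGeometry MonoidalCategory CartesianMonoidalCategory
open scoped MonObj

namespace Literature.AlgebraicGeometry.AbelianSchemes.AbelianSchemeOver

open Literature.AlgebraicGeometry.RelativeSpec

variable {S : Scheme.{u}} (A : AbelianSchemeOver S) {Y : Scheme.{u}} (u : S ⟶ Y) (K : Subgroup A.Sections)
  [Finite K] [Y.IsSeparated] [IsSeparated (A.X.hom ≫ u)] [S.IsSeparated]
  (hcov : ∀ x : A.left, ∃ O : (A.translationActionOver u K).StableAffineOpens, x ∈ O.1)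

/-- **The group law of `A` descends to `A/K` and `ψ : A → A/K` is a homomorphism** (the hypothesis `hG` of
`quotientBy`): for a COMMUTATIVE abelian scheme over `S → Y` with `Y` affine and `K ⊆ A(S)` acting without
fixed geometric points, by ★ `IsGeometricQuotient.exists_grpObj_isMonHom_of_free` with
`τ := translationAut ∘ K.subtype`. [cite: MumfordAV1970, §7 Thm. 4 (p. 72)] -/
theorem exists_grpObj_isMonHom_quotientMk [IsAffine Y] [IsCommMonObj A.X]
    (hfree : ∀ (Ω : Type u) [Field Ω] [IsAlgClosed Ω] (x : Spec (.of Ω) ⟶ A.left) (σ : K), σ ≠ 1 →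
      x ≫ (A.translation (σ : A.Sections)).left ≠ x) :
    ∃ _ : GrpObj (A.quotientOver u K), IsMonHom (A.quotientMk u K hcov) := by
  haveI := A.isAffineHom_quotientMk_left u K hcov
  haveI := A.isSeparated_quotientOver_left u K hcov
  exact ActionOver.IsGeometricQuotient.exists_grpObj_isMonHom_of_free
    (A.isGeometricQuotient_quotientActionOver u K hcov) (fun Ω _ _ x σ hσ => hfree Ω x σ hσ)
    (A.translationAut.comp K.subtype) (fun _ => rfl)
    (fun σ => by
      rw [MonoidHom.comp_apply, translationAut_hom, ← Category.assoc, translation_whiskerRight_comp_mul,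
        Category.assoc, K.subtype_apply, translation_comp_quotientMk])
    (fun σ => by
      rw [MonoidHom.comp_apply, translationAut_hom, ← Category.assoc, whiskerLeft_translation_comp_mul,
        Category.assoc, K.subtype_apply, translation_comp_quotientMk])
    (fun σ => by
      rw [MonoidHom.comp_apply, translationAut_hom, ← Category.assoc, translation_comp_inv, Category.assoc,
        K.subtype_apply, ← Subgroup.coe_inv, translation_comp_quotientMk])

include hcov in
/-- **The fibres of `A/K → S` are geometrically connected** (the hypothesis `hgc` of `quotientBy`): they are
the images of the geometrically connected fibres of `A → S` under the surjective `ψ`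
(★ `Morphisms.geometricallyConnected_of_surjective_comp`). [cite: MumfordAV1970, §7 Thm. 4 (p. 72)] -/
theorem geometricallyConnected_quotientOver_hom : GeometricallyConnected (A.quotientOver u K).hom := by
  haveI : Surjective (A.quotientMk u K hcov).left := ⟨A.quotientMk_left_surjective u K hcov⟩
  haveI : GeometricallyConnected ((A.quotientMk u K hcov).left ≫ (A.quotientOver u K).hom) := by
    rw [Over.w]; exact A.geometricallyConnected
  exact Morphisms.geometricallyConnected_of_surjective_comp (A.quotientMk u K hcov).left _

end Literature.AlgebraicGeometry.AbelianSchemes.AbelianSchemeOver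

end
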